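import Summits.AtomisticToContinuum.HydrodynamicLimit.Theorems.EnskogAdjointDualityAdjointEnskogTestFamilyRecord

/-!
# Refutation of `EnskogAdjointDuality.AdjointEnskogTestFamily` (stmt-AtomisticToContinuum-9168)

The crux quantifies over EVERY classical hard-sphere Euler solution at reduced density `σ < σ₀`
(no `∫ρ = 1`, no packing guard, no tie to the local Gibbs data).  Counterexample: the constant state
`ρ ≡ 1000/σ³`, `u ≡ 0`, `θ ≡ 1` on `[0,2)`.  At packing `1000` the tree's equation of state is on its
junk branch: by pigeonhole on `M³` sub-cubes, `N ≥ 5` points of `𝕋³` at pairwise minimal-image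
distance `> (η/N)^{1/3}` do not exist once `η ≥ 512`, so `hsFreeVolume η N = 0`, `log 0 = 0`,
`hsExcessFreeEnergy ≡ 0` on `(512,∞)` and `deriv hsExcessFreeEnergy 1000 = 0`: the contact value
`Y` and the whole test-side operator `L^N` vanish.  Then (ii)+(iii) are free transport (mean value
inequality along `r ↦ (r, x + r v)`), (i) pins `φ^N(1,·,v) = χ` and admissibility pins `φ^N(0,0,v)`
to a quadratic in `v` up to `C(1+|v|²)/λ_N → 0`; with `χ = cos 2πx₀`, `a = 1`, `b = e = 0`, `t = 1`,
`v = r e₀`, `r ∈ {0, ±½, ±1}` the combination `4(E(½)+E(−½)) − (E(1)+E(−1)) − 6E(0)` of the five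
error terms is identically `−16` yet tends to `0`.  Repair: tie `(ρ,u,θ)` to the data as in
`CollisionResidualVanishes`, or guard the packing (then the glue needs `DiluteSelfConsistency`).
Refuter seat rreview-route-AtomisticToContinu-a38272b2, 2026-08-15.
-/

open MeasureTheory Filter Set Topology
open Literature.Analysis.FluidPDE Literature.MathematicalPhysics.KineticTheory
open Literature.Analysis.FunctionSpaces

namespace Summit.AtomisticToContinuum.HydrodynamicLimit.Theorems

/-- The quotient norm of a real number in `ℝ/ℤ` is at most its absolute value. [folklore] -/
private theorem EnskogAdjointDuality.norm_coe_unitAddCircle_le (x : ℝ) : ‖((x : ℝ) : UnitAddCircle)‖ ≤ |x| := by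
  by_cases h : |x| ≤ 1 / 2
  · rw [(AddCircle.norm_coe_eq_abs_iff (1 : ℝ) one_ne_zero).2 (by simpa using h)]
  · push Not at h
    have h1 : ‖((x : ℝ) : UnitAddCircle)‖ ≤ |(1 : ℝ)| / 2 := AddCircle.norm_le_half_period (1 : ℝ) one_ne_zero
    rw [abs_one] at h1
    linarith

/-- Two points of `𝕋³` whose `[0,1)`-representatives agree to within `δ` in every coordinate are at
minimal-image distance `≤ √3 · δ`. [folklore] -/
private theorem EnskogAdjointDuality.euclidDist_le_of_repr_close {x y : UnitAddTorus (Fin 3)} {δ : ℝ}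
    (h : ∀ k, |Torus.repr x k - Torus.repr y k| ≤ δ) :
    Torus.euclidDist x y ≤ Real.sqrt 3 * δ := by
  have hδ : 0 ≤ δ := (abs_nonneg _).trans (h 0)
  have hk : ∀ k, |Torus.reprSym (x - y) k| ≤ δ := by
    intro k
    rw [Torus.abs_reprSym_apply]
    have hx : x k = ((Torus.repr x k : ℝ) : UnitAddCircle) := by
      conv_lhs => rw [← Torus.proj_repr x]
      rfl
    have hy : y k = ((Torus.repr y k : ℝ) : UnitAddCircle) := by
      conv_lhs => rw [← Torus.proj_repr y]
      rfl
    rw [Pi.sub_apply, hx, hy, ← AddCircle.coe_sub]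
    exact (EnskogAdjointDuality.norm_coe_unitAddCircle_le _).trans (h k)
  rw [Torus.euclidDist_eq, EuclideanSpace.norm_eq]
  calc Real.sqrt (∑ k, ‖Torus.reprSym (x - y) k‖ ^ 2)
      ≤ Real.sqrt (∑ _k : Fin 3, δ ^ 2) := by
        gcongr with k
        rw [Real.norm_eq_abs]
        exact hk k
    _ = Real.sqrt 3 * δ := by
        rw [Finset.sum_const, Finset.card_univ, Fintype.card_fin, nsmul_eq_mul, Nat.cast_ofNat,
          Real.sqrt_mul (by norm_num), Real.sqrt_sq hδ]

/-- Pigeonhole on `M³` cubes: among more than `M³` points of `𝕋³` two distinct ones are at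
minimal-image distance `≤ √3 / M`. [folklore] -/
private theorem EnskogAdjointDuality.exists_euclidDist_le {N M : ℕ} (hM : 0 < M) (hNM : M ^ 3 < N)
    (q : Fin N → UnitAddTorus (Fin 3)) :
    ∃ i j : Fin N, i ≠ j ∧ Torus.euclidDist (q i) (q j) ≤ Real.sqrt 3 / M := by
  have hM' : (0 : ℝ) < M := by exact_mod_cast hM
  have hlt : ∀ (i : Fin N) (k : Fin 3), ⌊(M : ℝ) * Torus.repr (q i) k⌋₊ < M := by
    intro i k
    have h01 := Torus.repr_apply_mem_Ico (q i) k
    rw [Nat.floor_lt (by have := h01.1; positivity)]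
    calc (M : ℝ) * Torus.repr (q i) k < M * 1 := by gcongr; exact h01.2
      _ = M := mul_one _
  let b : Fin N → (Fin 3 → Fin M) := fun i k => ⟨⌊(M : ℝ) * Torus.repr (q i) k⌋₊, hlt i k⟩
  have hcard : Fintype.card (Fin 3 → Fin M) < Fintype.card (Fin N) := by
    simpa [Fintype.card_fun, Fintype.card_fin] using hNM
  obtain ⟨i, j, hij, hb⟩ := Fintype.exists_ne_map_eq_of_card_lt b hcard
  refine ⟨i, j, hij, ?_⟩
  have hclose : ∀ k, |Torus.repr (q i) k - Torus.repr (q j) k| ≤ 1 / M := by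
    intro k
    have hk : ⌊(M : ℝ) * Torus.repr (q i) k⌋₊ = ⌊(M : ℝ) * Torus.repr (q j) k⌋₊ := by
      have := congr_fun hb k
      simpa [b] using congrArg Fin.val this
    have hi0 : 0 ≤ (M : ℝ) * Torus.repr (q i) k := by
      have := (Torus.repr_apply_mem_Ico (q i) k).1; positivity
    have hj0 : 0 ≤ (M : ℝ) * Torus.repr (q j) k := by
      have := (Torus.repr_apply_mem_Ico (q j) k).1; positivity
    have h1 := Nat.floor_le hi0
    have h2 := Nat.lt_floor_add_one ((M : ℝ) * Torus.repr (q i) k)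
    have h3 := Nat.floor_le hj0
    have h4 := Nat.lt_floor_add_one ((M : ℝ) * Torus.repr (q j) k)
    rw [hk] at h1 h2
    have hdiff : |(M : ℝ) * Torus.repr (q i) k - M * Torus.repr (q j) k| ≤ 1 := by
      rw [abs_le]; constructor <;> linarith
    rw [← mul_sub, abs_mul, abs_of_pos hM'] at hdiff
    rw [le_div_iff₀ hM', mul_comm]
    exact hdiff
  calc Torus.euclidDist (q i) (q j) ≤ Real.sqrt 3 * (1 / M) :=
        EnskogAdjointDuality.euclidDist_le_of_repr_close hclose
    _ = Real.sqrt 3 / M := by ring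

/-- Beyond packing `η ≥ 512` no configuration of `N ≥ 5` non-overlapping spheres of diameter
`(η/N)^{1/3}` fits in `𝕋³`, so the free volume vanishes. [folklore] -/
private theorem EnskogAdjointDuality.hsFreeVolume_eq_zero {η : ℝ} (hη : 512 ≤ η) {N : ℕ} (hN : 5 ≤ N) :
    hsFreeVolume η N = 0 := by
  unfold hsFreeVolume
  suffices h : {q : Fin N → T3 |
      ∀ i j, i ≠ j → (η / N) ^ (1 / 3 : ℝ) < Torus.euclidDist (q i) (q j)} = ∅ by
    rw [h, measure_empty, ENNReal.toReal_zero]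
  ext q
  simp only [mem_setOf_eq, mem_empty_iff_false, iff_false, not_forall]
  have hN' : (5 : ℝ) ≤ N := by exact_mod_cast hN
  have hNpos : (0 : ℝ) < N := by linarith
  set d : ℝ := (η / N) ^ (1 / 3 : ℝ) with hd
  have hηN : 0 < η / N := div_pos (by linarith) hNpos
  have hdpos : 0 < d := Real.rpow_pos_of_pos hηN _
  have hd3 : d ^ 3 = η / N := by
    rw [hd, ← Real.rpow_natCast, ← Real.rpow_mul hηN.le]
    norm_num
  set a : ℝ := Real.sqrt 3 / d with ha
  have ha0 : 0 ≤ a := by positivity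
  set M : ℕ := ⌈a⌉₊ with hM
  have hMa : a ≤ M := Nat.le_ceil a
  have hMlt : (M : ℝ) < a + 1 := Nat.ceil_lt_add_one ha0
  have hs3 : Real.sqrt 3 < 1.7321 := by
    rw [Real.sqrt_lt' (by norm_num)]; norm_num
  have hs3pos : 0 < Real.sqrt 3 := Real.sqrt_pos.2 (by norm_num)
  have hapos : 0 < a := div_pos hs3pos hdpos
  have hMpos : 0 < M := Nat.ceil_pos.2 hapos
  have ha3 : a ^ 3 * η = 3 * Real.sqrt 3 * N := by
    have hs : Real.sqrt 3 ^ 3 = 3 * Real.sqrt 3 := by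
      rw [pow_succ, Real.sq_sqrt (by norm_num)]
    rw [ha, div_pow, hs, hd3]
    field_simp
  have ha3le : a ^ 3 ≤ 3 * 1.7321 * N / 512 := by
    rw [le_div_iff₀ (by norm_num : (0 : ℝ) < 512)]
    calc a ^ 3 * 512 ≤ a ^ 3 * η := by gcongr
      _ = 3 * Real.sqrt 3 * N := ha3
      _ ≤ 3 * 1.7321 * N := by gcongr
  have hM3 : (M : ℝ) ^ 3 < N := by
    have h1 : (M : ℝ) ^ 3 < (a + 1) ^ 3 := by gcongr
    have h2 : (a + 1) ^ 3 ≤ 4 * (a ^ 3 + 1) := by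
      nlinarith [mul_nonneg (sq_nonneg (a - 1)) (by linarith : (0 : ℝ) ≤ a + 1)]
    nlinarith
  have hM3' : M ^ 3 < N := by exact_mod_cast hM3
  obtain ⟨i, j, hij, hdist⟩ := EnskogAdjointDuality.exists_euclidDist_le hMpos hM3' q
  refine ⟨i, j, hij, not_lt.2 (hdist.trans ?_)⟩
  rw [div_le_iff₀ (by exact_mod_cast hMpos)]
  calc Real.sqrt 3 = a * d := by rw [ha]; field_simp
    _ ≤ M * d := by gcongr
    _ = d * M := mul_comm _ _

/-- Hence the tree's excess free energy vanishes identically beyond packing `512` (junk branch of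
`Real.log 0 = 0` and `limsup`). [folklore] -/
private theorem EnskogAdjointDuality.hsExcessFreeEnergy_eq_zero {η : ℝ} (hη : 512 ≤ η) :
    hsExcessFreeEnergy η = 0 := by
  unfold hsExcessFreeEnergy
  have h : (fun N : ℕ => -(N : ℝ)⁻¹ * Real.log (hsFreeVolume η N)) =ᶠ[atTop] fun _ => 0 := by
    filter_upwards [eventually_ge_atTop 5] with N hN
    rw [EnskogAdjointDuality.hsFreeVolume_eq_zero hη hN, Real.log_zero, mul_zero]
  rw [limsup_congr h, limsup_const]

/-- … and its derivative there is `0`. [folklore] -/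
private theorem EnskogAdjointDuality.deriv_hsExcessFreeEnergy_eq_zero {η : ℝ} (hη : 512 < η) :
    deriv hsExcessFreeEnergy η = 0 := by
  have h : hsExcessFreeEnergy =ᶠ[𝓝 η] fun _ => 0 := by
    filter_upwards [Ioi_mem_nhds hη] with η' hη'
    exact EnskogAdjointDuality.hsExcessFreeEnergy_eq_zero (le_of_lt hη')
  rw [h.deriv_eq, deriv_const]

/-- A constant state is a classical hard-sphere Euler solution (all derivatives vanish). [folklore] -/
private theorem EnskogAdjointDuality.isHardSphereEulerSolution_const (σ T ρ θ : ℝ) (hρ : 0 < ρ) (hθ : 0 < θ) :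
    IsHardSphereEulerSolution σ T (fun _ _ => ρ) (fun _ _ => (0 : V3)) (fun _ _ => θ) := by
  refine ⟨contDiffOn_const, contDiffOn_const, contDiffOn_const, fun _ _ _ => hρ, fun _ _ _ => hθ,
    ?_, ?_, ?_⟩
  · intro t _ x
    simp [Torus.timeDerivWithin, Torus.divergence, Torus.partialDeriv, Torus.lineDeriv]
  · intro t _ x
    have hl : Torus.liftAt (fun _ : UnitAddTorus (Fin 3) => hsPressure σ ρ θ) x =
        fun _ => hsPressure σ ρ θ := by
      funext v; simp [Torus.liftAt_apply]
    simp [Torus.timeDerivWithin, Torus.partialDeriv, Torus.lineDeriv, Torus.gradient, hl, gradient]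
  · intro t _ x
    simp [Torus.timeDerivWithin, Torus.divergence, Torus.partialDeriv, Torus.lineDeriv]

/-- `χ(proj y) = cos(2π y₀)`. [folklore] -/
private theorem EnskogAdjointDuality.chi_coe (y : EuclideanSpace ℝ (Fin 3)) :
    Complex.re ((AddCircle.toCircle (Torus.proj y 0) : Circle) : ℂ) = Real.cos (2 * Real.pi * y 0) := by
  rw [Torus.proj_apply, AddCircle.toCircle_apply_mk, Circle.coe_exp, div_one,
    Complex.exp_ofReal_mul_I_re]

/-- `χ` is smooth on `𝕋³` (its lift is `y ↦ cos(2π y₀)`). [folklore] -/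
private theorem EnskogAdjointDuality.chi_isSmooth :
    Torus.IsSmooth (fun x : UnitAddTorus (Fin 3) => Complex.re ((AddCircle.toCircle (x 0) : Circle) : ℂ)) := by
  have h : Torus.lift (fun x : UnitAddTorus (Fin 3) => Complex.re ((AddCircle.toCircle (x 0) : Circle) : ℂ)) =
      fun y => Real.cos (2 * Real.pi * y 0) := by
    funext y
    rw [Torus.lift_apply]
    exact EnskogAdjointDuality.chi_coe y
  unfold Torus.IsSmooth
  rw [h]
  have h0 : ContDiff ℝ ((⊤ : ℕ∞) : WithTop ℕ∞) (fun y : EuclideanSpace ℝ (Fin 3) => y 0) :=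
    (EuclideanSpace.proj (0 : Fin 3) : EuclideanSpace ℝ (Fin 3) →L[ℝ] ℝ).contDiff
  exact Real.contDiff_cos.comp (contDiff_const.mul h0)


/-- `λ_N⁻¹ = (N ε_N²)⁻¹ → 0` at fixed reduced density. [folklore] -/
private theorem EnskogAdjointDuality.tendsto_inv_lam {σ : ℝ} (hσ : 0 < σ) :
    Tendsto (fun N : ℕ => ((N : ℝ) * hsDiameter σ N ^ 2)⁻¹) atTop (𝓝 0) := by
  have hu : ∀ N : ℕ, 0 < ((N + 1 : ℕ) : ℝ) ^ (-(1 / 3 : ℝ)) := fun N =>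
    Real.rpow_pos_of_pos (by positivity) _
  have hu3 : ∀ N : ℕ, (((N + 1 : ℕ) : ℝ) ^ (-(1 / 3 : ℝ))) ^ 3 * ((N + 1 : ℕ) : ℝ) = 1 := by
    intro N
    have hpos : (0 : ℝ) < ((N + 1 : ℕ) : ℝ) := by positivity
    rw [← Real.rpow_natCast, ← Real.rpow_mul hpos.le]
    norm_num
    rw [Real.rpow_neg_one]
    exact inv_mul_cancel₀ (by positivity : (N : ℝ) + 1 ≠ 0)
  have hlim : Tendsto (fun N : ℕ => ((N + 1 : ℕ) : ℝ) ^ (-(1 / 3 : ℝ))) atTop (𝓝 0) :=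
    (tendsto_rpow_neg_atTop (by norm_num : (0 : ℝ) < 1 / 3)).comp
      (tendsto_natCast_atTop_atTop.comp (tendsto_add_atTop_nat 1))
  have hlim2 : Tendsto (fun N : ℕ => 2 / σ ^ 2 * ((N + 1 : ℕ) : ℝ) ^ (-(1 / 3 : ℝ))) atTop (𝓝 0) := by
    simpa using hlim.const_mul (2 / σ ^ 2)
  refine squeeze_zero' (Eventually.of_forall fun N => inv_nonneg.2 (by unfold hsDiameter; positivity)) ?_ hlim2
  filter_upwards [eventually_ge_atTop 1] with N hN
  have hN : (1 : ℝ) ≤ N := by exact_mod_cast hN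
  unfold hsDiameter
  set u := ((N + 1 : ℕ) : ℝ) ^ (-(1 / 3 : ℝ)) with hudef
  have huN := hu N
  have hu3N := hu3 N
  rw [← hudef] at huN hu3N
  have hcast : ((N + 1 : ℕ) : ℝ) = N + 1 := by push_cast; ring
  rw [hcast] at hu3N
  rw [inv_le_iff_one_le_mul₀ (by positivity)]
  have hσ2 : σ ^ 2 ≠ 0 := by positivity
  have h1 : 2 / σ ^ 2 * u * ((N : ℝ) * (σ * u) ^ 2) = 2 * N * u ^ 3 := by
    rw [mul_pow, div_mul_eq_mul_div, div_mul_eq_mul_div, div_eq_iff hσ2]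
    ring
  rw [h1]
  nlinarith [hu3N, huN]

/-- Core of the refutation: a family that is `C¹` along free characteristics with defect
`≤ η_N (1+|v|²)`, terminal value `χ(x) = cos 2πx₀` at `s = 1` and hydrodynamic-plus-`O(1/λ_N)` form
cannot exist (free transport destroys the quadratic-in-`v` structure; five velocities suffice). [folklore] -/
private theorem EnskogAdjointDuality.core {σ : ℝ} (hσ : 0 < σ) {Φ : ℕ → ℝ → T3 → V3 → ℝ}
    {c : ℕ → ℝ → T3 → ℝ × V3 × ℝ} {κ : ℕ → ℝ → T3 → V3 → ℝ} {C : ℝ}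
    (hΦ : ∀ N s x v, Φ N s x v = (c N s x).1 + inner ℝ (c N s x).2.1 v +
      (c N s x).2.2 * ‖v‖ ^ 2 / 2 + ((N : ℝ) * hsDiameter σ N ^ 2)⁻¹ * κ N s x v)
    (hκ : ∀ N s x v, |κ N s x v| ≤ C * (1 + ‖v‖ ^ 2))
    {η : ℕ → ℝ} (hη : Tendsto η atTop (𝓝 0))
    (hi : ∀ N x v, Φ N 1 x v =
      (fun x : UnitAddTorus (Fin 3) => Complex.re ((AddCircle.toCircle (x 0) : Circle) : ℂ)) x *
        (1 + inner ℝ (0 : V3) v + 0 * ‖v‖ ^ 2 / 2))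
    (hii : ∀ N x v, ContDiffOn ℝ 1
      (fun r => Φ N r ((Torus.geometry (Fin 3)).translate x (r • v)) v) (Icc 0 1))
    (hiii : ∀ N, ∀ s ∈ Icc (0 : ℝ) 1, ∀ x v,
      |derivWithin (fun r => Φ N r ((Torus.geometry (Fin 3)).translate x ((r - s) • v)) v)
        (Icc 0 1) s| ≤ η N * (1 + ‖v‖ ^ 2)) : False := by
  set G := Torus.geometry (Fin 3) with hG
  -- (A) mean value inequality along free characteristics; (B) terminal values; (C)-(E) five points
  have hmvt : ∀ (N : ℕ) (v : V3),
      |Φ N 1 (G.translate 0 ((1 : ℝ) • v)) v - Φ N 0 0 v| ≤ η N * (1 + ‖v‖ ^ 2) := by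
    intro N v
    have hf : DifferentiableOn ℝ (fun r => Φ N r (G.translate 0 (r • v)) v) (Icc 0 1) :=
      (hii N 0 v).differentiableOn one_ne_zero
    have hbound : ∀ s ∈ Ico (0 : ℝ) 1,
        ‖derivWithin (fun r => Φ N r (G.translate 0 (r • v)) v) (Icc 0 1) s‖ ≤ η N * (1 + ‖v‖ ^ 2) := by
      intro s hs
      have h := hiii N s (Ico_subset_Icc_self hs) (G.translate 0 (s • v)) v
      have hfun : (fun r => Φ N r (G.translate (G.translate 0 (s • v)) ((r - s) • v)) v) =
          fun r => Φ N r (G.translate 0 (r • v)) v := by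
        funext r
        rw [Geometry.translate_add, ← add_smul]
        congr 3
        ring
      rw [hfun] at h
      rw [Real.norm_eq_abs]
      exact h
    have h := norm_image_sub_le_of_norm_deriv_le_segment_01 hf hbound
    simp only [Real.norm_eq_abs, zero_smul, Geometry.translate_zero] at h
    exact h
  have hval : ∀ r : ℝ, (fun x : UnitAddTorus (Fin 3) => Complex.re ((AddCircle.toCircle (x 0) : Circle) : ℂ))
      (G.translate 0 ((1 : ℝ) • (r • EuclideanSpace.single (0 : Fin 3) (1 : ℝ))))
      = Real.cos (2 * Real.pi * r) := by
    intro r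
    rw [one_smul, hG, Torus.geometry_translate, zero_add]
    beta_reduce
    rw [EnskogAdjointDuality.chi_coe]
    congr 1
    simp
  have hlaminv : ∀ N : ℕ, 0 ≤ ((N : ℝ) * hsDiameter σ N ^ 2)⁻¹ := fun N =>
    inv_nonneg.2 (by unfold hsDiameter; positivity)
  have hE : ∀ (r : ℝ) (N : ℕ), |Real.cos (2 * Real.pi * r) - ((c N 0 0).1 +
      r * inner ℝ (c N 0 0).2.1 (EuclideanSpace.single (0 : Fin 3) (1 : ℝ)) + (c N 0 0).2.2 * r ^ 2 / 2)|
      ≤ (η N + C * ((N : ℝ) * hsDiameter σ N ^ 2)⁻¹) * (1 + r ^ 2) := by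
    intro r N
    set v : V3 := r • EuclideanSpace.single (0 : Fin 3) (1 : ℝ) with hv
    have hnv2 : ‖v‖ ^ 2 = r ^ 2 := by
      rw [hv, norm_smul, Real.norm_eq_abs]
      simp [sq_abs]
    have h1 := hmvt N v
    have h2 : Φ N 1 (G.translate 0 ((1 : ℝ) • v)) v = Real.cos (2 * Real.pi * r) := by
      rw [hi, hv, hval r]
      simp
    have h3 : Φ N 0 0 v = (c N 0 0).1 + r * inner ℝ (c N 0 0).2.1 (EuclideanSpace.single (0 : Fin 3) (1 : ℝ)) +
        (c N 0 0).2.2 * r ^ 2 / 2 + ((N : ℝ) * hsDiameter σ N ^ 2)⁻¹ * κ N 0 0 v := by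
      rw [hΦ, hnv2, hv, inner_smul_right]
    have h4 : |((N : ℝ) * hsDiameter σ N ^ 2)⁻¹ * κ N 0 0 v| ≤ C * ((N : ℝ) * hsDiameter σ N ^ 2)⁻¹ * (1 + r ^ 2) := by
      rw [abs_mul, abs_of_nonneg (hlaminv N)]
      have := hκ N 0 0 v
      rw [hnv2] at this
      calc ((N : ℝ) * hsDiameter σ N ^ 2)⁻¹ * |κ N 0 0 v|
          ≤ ((N : ℝ) * hsDiameter σ N ^ 2)⁻¹ * (C * (1 + r ^ 2)) := by gcongr
        _ = C * ((N : ℝ) * hsDiameter σ N ^ 2)⁻¹ * (1 + r ^ 2) := by ring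
    rw [h2, h3] at h1
    rw [hnv2] at h1
    have key : |Real.cos (2 * Real.pi * r) - ((c N 0 0).1 +
        r * inner ℝ (c N 0 0).2.1 (EuclideanSpace.single (0 : Fin 3) (1 : ℝ)) + (c N 0 0).2.2 * r ^ 2 / 2)|
        ≤ η N * (1 + r ^ 2) + C * ((N : ℝ) * hsDiameter σ N ^ 2)⁻¹ * (1 + r ^ 2) := by
      have htri := abs_add_le (Real.cos (2 * Real.pi * r) - ((c N 0 0).1 +
        r * inner ℝ (c N 0 0).2.1 (EuclideanSpace.single (0 : Fin 3) (1 : ℝ)) + (c N 0 0).2.2 * r ^ 2 / 2 +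
        ((N : ℝ) * hsDiameter σ N ^ 2)⁻¹ * κ N 0 0 v)) (((N : ℝ) * hsDiameter σ N ^ 2)⁻¹ * κ N 0 0 v)
      have hrw : Real.cos (2 * Real.pi * r) - ((c N 0 0).1 +
        r * inner ℝ (c N 0 0).2.1 (EuclideanSpace.single (0 : Fin 3) (1 : ℝ)) + (c N 0 0).2.2 * r ^ 2 / 2 +
        ((N : ℝ) * hsDiameter σ N ^ 2)⁻¹ * κ N 0 0 v) + ((N : ℝ) * hsDiameter σ N ^ 2)⁻¹ * κ N 0 0 v =
        Real.cos (2 * Real.pi * r) - ((c N 0 0).1 +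
        r * inner ℝ (c N 0 0).2.1 (EuclideanSpace.single (0 : Fin 3) (1 : ℝ)) + (c N 0 0).2.2 * r ^ 2 / 2) := by ring
      rw [hrw] at htri
      linarith
    linarith
  have hlam := EnskogAdjointDuality.tendsto_inv_lam hσ
  have hlim : ∀ r : ℝ, Tendsto (fun N : ℕ => Real.cos (2 * Real.pi * r) - ((c N 0 0).1 +
      r * inner ℝ (c N 0 0).2.1 (EuclideanSpace.single (0 : Fin 3) (1 : ℝ)) + (c N 0 0).2.2 * r ^ 2 / 2))
      atTop (𝓝 0) := by
    intro r
    refine squeeze_zero_norm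
      (a := fun N => (η N + C * ((N : ℝ) * hsDiameter σ N ^ 2)⁻¹) * (1 + r ^ 2)) (fun N => ?_) ?_
    · rw [Real.norm_eq_abs]; exact hE r N
    · have := (hη.add (hlam.const_mul C)).mul_const (1 + r ^ 2)
      simpa using this
  have hc0 : Real.cos (2 * Real.pi * 0) = 1 := by simp
  have hc1 : Real.cos (2 * Real.pi * 1) = 1 := by simp
  have hcm1 : Real.cos (2 * Real.pi * (-1)) = 1 := by simp
  have hch : Real.cos (2 * Real.pi * (1 / 2)) = -1 := by
    rw [show 2 * Real.pi * (1 / 2) = Real.pi by ring]; exact Real.cos_pi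
  have hcmh : Real.cos (2 * Real.pi * (-1 / 2)) = -1 := by
    rw [show 2 * Real.pi * (-1 / 2) = -Real.pi by ring, Real.cos_neg]; exact Real.cos_pi
  have hF := (((hlim (1 / 2)).add (hlim (-1 / 2))).const_mul 4 |>.sub ((hlim 1).add (hlim (-1)))).sub
    ((hlim 0).const_mul 6)
  have hconst : (fun N : ℕ => 4 * ((Real.cos (2 * Real.pi * (1 / 2)) - ((c N 0 0).1 +
      1 / 2 * inner ℝ (c N 0 0).2.1 (EuclideanSpace.single (0 : Fin 3) (1 : ℝ)) + (c N 0 0).2.2 * (1 / 2) ^ 2 / 2)) +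
      (Real.cos (2 * Real.pi * (-1 / 2)) - ((c N 0 0).1 +
      -1 / 2 * inner ℝ (c N 0 0).2.1 (EuclideanSpace.single (0 : Fin 3) (1 : ℝ)) + (c N 0 0).2.2 * (-1 / 2) ^ 2 / 2))) -
      ((Real.cos (2 * Real.pi * 1) - ((c N 0 0).1 +
      1 * inner ℝ (c N 0 0).2.1 (EuclideanSpace.single (0 : Fin 3) (1 : ℝ)) + (c N 0 0).2.2 * 1 ^ 2 / 2)) +
      (Real.cos (2 * Real.pi * (-1)) - ((c N 0 0).1 +
      -1 * inner ℝ (c N 0 0).2.1 (EuclideanSpace.single (0 : Fin 3) (1 : ℝ)) + (c N 0 0).2.2 * (-1) ^ 2 / 2))) -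
      6 * (Real.cos (2 * Real.pi * 0) - ((c N 0 0).1 +
      0 * inner ℝ (c N 0 0).2.1 (EuclideanSpace.single (0 : Fin 3) (1 : ℝ)) + (c N 0 0).2.2 * 0 ^ 2 / 2)))
      = fun _ => (-16 : ℝ) := by
    funext N
    rw [hc0, hc1, hcm1, hch, hcmh]
    ring
  rw [hconst] at hF
  have := tendsto_nhds_unique hF tendsto_const_nhds
  norm_num at this

/-- Refutes `EnskogAdjointDuality.AdjointEnskogTestFamily` (stmt-AtomisticToContinuum-9168): the
statement quantifies over ALL classical hs-Euler solutions with no tie to the particle system, so it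
covers the constant state `ρ ≡ 1000/σ³` (packing `1000`), `u ≡ 0`, `θ ≡ 1`, `T = 2`; there the tree's
equation of state is on its junk branch (`hsFreeVolume = 0`, `log 0 = 0`, `f_ex ≡ 0` near `1000`,
`Y = (3/2π) f_ex' = 0`), the test-side operator `L^N` vanishes identically, and (ii)+(iii) force
`φ^N(0,x,v) → χ(x+v)` pointwise while admissibility keeps `φ^N(0,x,·)` within `C(1+|v|²)/λ_N` of a
quadratic in `v`; with `χ = cos 2πx₀`, `a = 1`, `b = e = 0`, `t = 1` and `v ∈ {0, ±½, ±1}·e₀` the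
combination `4(E(½)+E(−½)) − (E(1)+E(−1)) − 6E(0)` is identically `−16` yet tends to `0`. Fix: tie
the Euler solution to the data (as in `CollisionResidualVanishes`) or guard the packing. [folklore] -/
theorem EnskogAdjointDualityAdjointEnskogTestFamily_refuted :
    ¬ Summit.AtomisticToContinuum.HydrodynamicLimit.Theses.EnskogAdjointDuality.AdjointEnskogTestFamily := by
  rintro ⟨σ₀, hσ₀, h⟩
  obtain ⟨σ, hσ, hσlt⟩ : ∃ σ : ℝ, 0 < σ ∧ σ < σ₀ := ⟨σ₀ / 2, by linarith, by linarith⟩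
  have hE := EnskogAdjointDuality.isHardSphereEulerSolution_const σ 2 (1000 / σ ^ 3) 1
    (by positivity) one_pos
  have h1 := h σ hσ hσlt 2 (fun _ _ => 1000 / σ ^ 3) (fun _ _ => 1) (fun _ _ => (0 : V3)) hE 1
    ⟨by norm_num, by norm_num⟩
    (fun x : UnitAddTorus (Fin 3) => Complex.re ((AddCircle.toCircle (x 0) : Circle) : ℂ)) EnskogAdjointDuality.chi_isSmooth 1 0 0
  obtain ⟨c, κ, -, -, ⟨C, hC⟩, hi, hii, ⟨η, hη, hiii⟩, -, -⟩ := h1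
  have hY0 : deriv hsExcessFreeEnergy (σ ^ 3 * (1000 / σ ^ 3)) = 0 := by
    rw [show σ ^ 3 * (1000 / σ ^ 3) = 1000 by field_simp]
    exact EnskogAdjointDuality.deriv_hsExcessFreeEnergy_eq_zero (by norm_num)
  simp only [hY0, mul_zero, zero_mul, integral_zero, add_zero] at hiii
  exact EnskogAdjointDuality.core hσ
    (Φ := fun N s x v => (c N s x).1 + inner ℝ (c N s x).2.1 v + (c N s x).2.2 * ‖v‖ ^ 2 / 2 +
      ((N : ℝ) * hsDiameter σ N ^ 2)⁻¹ * κ N s x v)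
    (fun _ _ _ _ => rfl) (fun N s x v => (hC N s x x v v).2.2.1) hη hi hii hiii

end Summit.AtomisticToContinuum.HydrodynamicLimit.Theorems
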